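import Mathlib
import Literature.Computability.Complexity.CliqueTestGraphs
import Summits.PneNP.PneNP.Theorems.ConvexRankGatesCliqueBridge
import Summits.PneNP.PneNP.Theorems.ConvexRankGatesConvexGateBlindConverse
import Summits.PneNP.PneNP.Theorems.ConvexRankGatesConvexGateBlindOneGate

set_option linter.dupNamespace false

/-!
# PneNP / ConvexRankGates — `ConvexGateBlind`: the sparse-negative sub-case is already summit-hard

Helpers (`--supports stmt-PneNP-10680`). By `convexGateBlind_iff_canonical`
(`…ConvexGateBlindCanonical.lean`) the crux `ConvexGateBlind` is a statement about the explicit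
matrix `D_m[u, Q] = #(E(Q) ∖ u)` (rows: `k`-clique-free graphs `u`, columns: `k`-sets `Q`,
`k = ⌈m^δ⌉₊`): for every `ε > 0`, `D_m - εJ` has no polynomial cone factorisation. A lower-bound
proof chooses which rows (negatives) to use. This file shows that the rows with FEWER THAN `C(k,2)`
EDGES (near-cliques `E(Q') ∖ e`, sparse graphs — all trivially `k`-clique-free) cannot be the source
of hardness unless one proves the summit directly: Hrubeš's general matrix
`M(f)[y, x] = Hamming(x, y)` satisfies `Hamming(1_Q, u) = 2·#(E(Q) ∖ u) + #u - C(k,2)`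
(`hamming_cliqueVec_eq`), so on sparse rows `M(f) - εJ` is twice the canonical matrix at the shift
`(C(k,2) - #u + ε)/2 ≥ (1 + ε)/2`, and Hrubeš's Theorem 3 (`min_{ε>0} rk₊(M(f) - εJ) ≤ O(C(f) + n)`,
`C(f)` = Boolean circuit size; hypothesis `hT3` below) turns any polynomial B2
circuit for `CLIQUE(m, k)` into a polynomial NON-NEGATIVE factorisation of the canonical matrix on the
sparse rows at some shift `> 1/2`. Consequently (`pneNP_of_sparseCanonicalHard`): the natural
strengthening "for every `ε > 0`, `(#(E(Q) ∖ u) - ε)_{#u < C(k,2), #Q = k}` has no non-negative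
factorisation of size `≤ m^c`" (LP cone, sparse rows only) ALREADY IMPLIES `PneNP` — via
`cliqueBridge_proof`, with no convex gates, no Capture and no monotone circuit theory in between.
Reading for planners: a feasible line on the crux must draw its hardness from negatives with at
least `C(k,2)` edges (the dense side, where `M(f)` is a non-negative shift of `2 D_m` and Theorem 3
is void); a proof confined to sparse negatives would be a proof of `NP ⊄ P/poly`.
[Hrubeš 2020 (Comput. Complexity 29; ECCC TR19-034), Thm. 3; folklore bookkeeping]
-/

namespace Summit.PneNP.PneNP.Theorems

open Finset Filter Literature.Computability.Complexity

/-! ### The cited fact (taken as an explicit hypothesis)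

Hrubeš, *On ε-sensitive monotone computations*, Comput. Complexity 29 (2020) / ECCC TR19-034,
Theorem 3 (= Theorem 4 + Proposition 7(i) there): for every Boolean function `f` on `n` variables,
`min_{ε>0} rk₊(M(f) - εJ) ≤ O(C(f) + n)`, where `M(f)` is the `f⁻¹(0) × f⁻¹(1)` matrix of Hamming
distances, `rk₊` the non-negative rank and `C(f)` the Boolean circuit size. Below it is the
hypothesis `hT3`, written for circuits over the full binary basis `B2` (a constant factor away from
De Morgan circuits, absorbed in `κ`) with the rank bound unfolded into an explicit non-negative
factorisation `Hamming(x, y) - ε = ∑_{i<r} a_y(i) b_x(i)` on accepted `x` / rejected `y`: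
`∃ κ, ∀ ι f C, C.IsOver B2 → C.Computes f → ∃ ε > 0, ∃ r ≤ κ (C.size + #ι + 1), ∃ a b ≥ 0, …`.
(It is filed separately as a Literature named fact; this file does not depend on that filing.)
-/

/-! ### Edge counts and the Hamming identity -/

/-- The clique vector of `Q` has exactly `C(#Q, 2)` edges on. [folklore] -/
theorem card_filter_cliqueVec {m : ℕ} (Q : Finset (Fin m)) :
    (univ.filter fun e : (⊤ : SimpleGraph (Fin m)).edgeSet => cliqueVec Q e = true).card =
      Q.card.choose 2 := by
  classical
  rw [← Sym2.card_image_offDiag]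
  refine Finset.card_bij (fun e _ => (e : Sym2 (Fin m))) (fun e he => ?_) (fun e₁ _ e₂ _ h => Subtype.ext h)
    (fun z hz => ?_)
  · -- into the image of the off-diagonal of `Q`
    rw [Finset.mem_filter] at he
    obtain ⟨a, b, hab⟩ := sym2_exists_eq_mk (e : Sym2 (Fin m))
    have hne : a ≠ b := by
      have h2 := e.2
      rw [hab, SimpleGraph.mem_edgeSet, SimpleGraph.top_adj] at h2
      exact h2
    have hmem := he.2
    simp only [cliqueVec, decide_eq_true_eq] at hmem
    rw [Finset.mem_image]
    refine ⟨(a, b), ?_, hab.symm⟩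
    rw [Finset.mem_offDiag]
    exact ⟨hmem a (by rw [hab]; exact Sym2.mem_mk_left a b),
      hmem b (by rw [hab]; exact Sym2.mem_mk_right a b), hne⟩
  · -- onto
    rw [Finset.mem_image] at hz
    obtain ⟨⟨a, b⟩, hab, rfl⟩ := hz
    rw [Finset.mem_offDiag] at hab
    obtain ⟨ha, hb, hne⟩ := hab
    refine ⟨⟨s(a, b), (SimpleGraph.mem_edgeSet ⊤).2 ((SimpleGraph.top_adj a b).2 hne)⟩, ?_, rfl⟩
    rw [Finset.mem_filter]
    refine ⟨Finset.mem_univ _, ?_⟩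
    simp only [cliqueVec, decide_eq_true_eq]
    intro v hv
    rcases Sym2.mem_iff.1 hv with rfl | rfl
    · exact ha
    · exact hb

/-- A graph with fewer than `C(k,2)` edges is `k`-clique-free (a `k`-clique switches on all its
`C(k,2)` edges). [folklore] -/
theorem cliqueFn_eq_false_of_card_lt {m k : ℕ} (u : (⊤ : SimpleGraph (Fin m)).edgeSet → Bool)
    (hu : (univ.filter fun e => u e = true).card < k.choose 2) : cliqueFn m k u = false := by
  classical
  by_contra h
  rw [Bool.not_eq_false] at h
  obtain ⟨Q, hQ, hle⟩ := exists_cliqueVec_le_of_cliqueFn h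
  have hsub : (univ.filter fun e : (⊤ : SimpleGraph (Fin m)).edgeSet => cliqueVec Q e = true) ⊆
      (univ.filter fun e => u e = true) := by
    intro e he
    rw [Finset.mem_filter] at he ⊢
    exact ⟨he.1, hle e he.2⟩
  have := Finset.card_le_card hsub
  rw [card_filter_cliqueVec, hQ] at this
  omega

/-- **The Hamming identity.** `Hamming(1_Q, u) = 2·#(E(Q) ∖ u) + #u - #E(Q)`, written with real
indicator sums. [folklore] -/
theorem hamming_cliqueVec_eq {m : ℕ} (Q : Finset (Fin m)) (u : (⊤ : SimpleGraph (Fin m)).edgeSet → Bool) :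
    (hammingDist (cliqueVec Q) u : ℝ) =
      2 * ∑ e, (if u e then (0 : ℝ) else 1) * (if cliqueVec Q e then (1 : ℝ) else 0) +
        ∑ e, (if u e then (1 : ℝ) else 0) - ∑ e, (if cliqueVec Q e then (1 : ℝ) else 0) := by
  classical
  have h1 : (hammingDist (cliqueVec Q) u : ℝ) =
      ∑ e, (if cliqueVec Q e ≠ u e then (1 : ℝ) else 0) := by
    rw [hammingDist, Finset.natCast_card_filter]
  rw [h1, Finset.mul_sum, ← Finset.sum_add_distrib, ← Finset.sum_sub_distrib]
  refine Finset.sum_congr rfl fun e _ => ?_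
  cases cliqueVec Q e <;> cases u e <;> norm_num

/-! ### The sparse sub-case implies the summit -/

/-- Size bookkeeping: `κ (m^c + m² + 1) + 1 ≤ m^(c+4)` once `m² ≥ 3κ + 1` and `m ≥ 2`. [folklore] -/
theorem sparse_rank_bound {m c κ t n : ℕ} (hm : 2 ≤ m) (hκ : 3 * κ + 1 ≤ m ^ 2) (ht : t ≤ m ^ c)
    (hn : n ≤ m ^ 2) : κ * (t + n + 1) + 1 ≤ m ^ (c + 4) := by
  have h1 : 1 ≤ m := by omega
  have hP2 : m ^ 2 ≤ m ^ (c + 2) := Nat.pow_le_pow_right h1 (by omega)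
  have hPc : m ^ c ≤ m ^ (c + 2) := Nat.pow_le_pow_right h1 (by omega)
  have hP1 : 1 ≤ m ^ (c + 2) := Nat.one_le_pow _ _ h1
  have hsum : t + n + 1 ≤ 3 * m ^ (c + 2) := by omega
  calc κ * (t + n + 1) + 1 ≤ κ * (3 * m ^ (c + 2)) + m ^ (c + 2) :=
        Nat.add_le_add (Nat.mul_le_mul_left κ hsum) hP1
    _ = (3 * κ + 1) * m ^ (c + 2) := by ring
    _ ≤ m ^ 2 * m ^ (c + 2) := Nat.mul_le_mul_right _ hκ
    _ = m ^ (c + 4) := by ring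

/-- **Sparse-negative hardness of the canonical matrix forces super-polynomial B2 circuits for
CLIQUE** (conditional on Hrubeš's Theorem 3, hypothesis `hT3`). Hypothesis: for some
`δ ∈ (0, 1/2)` and every `c`, eventually in `m`, for every `ε > 0` the matrix `(#(E(Q) ∖ u) - ε)`
restricted to the rows `u` with FEWER THAN `C(⌈m^δ⌉₊, 2)` edges and the columns `#Q = ⌈m^δ⌉₊` has no
non-negative factorisation with `r ≤ m^c` terms — the LP-cone, sparse-row strengthening of the
right-hand side of `convexGateBlind_iff_canonical`. Conclusion: the hypothesis of `CliqueBridge`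
(no polynomial B2 circuits for `CLIQUE(m, ⌈m^δ⌉₊)`). Proof: a B2 circuit of size `≤ m^c` gives
(Hrubeš, Thm. 3) `ε > 0` and a non-negative factorisation of `Hamming(x, y) - ε` with
`r ≤ κ (m^c + #E + 1)` terms; on `x = 1_Q`, `y = u` sparse, `Hamming - ε = 2 (#(E(Q) ∖ u) - ε_u)`
with `ε_u = (C(k,2) - #u + ε)/2 ≥ (1+ε)/2` (`hamming_cliqueVec_eq`, `card_filter_cliqueVec`), so
halving and adding the non-negative column `(ε_u - (1+ε)/2)·1` factorises the sparse canonical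
matrix at the uniform shift `(1+ε)/2` with `r + 1 ≤ m^(c+4)` terms — contradiction.
[Hrubeš 2020, Thm. 3; folklore bookkeeping] -/
theorem cliqueB2Hard_of_sparseCanonicalHard :
    (∃ κ : ℕ, ∀ (ι : Type) [Fintype ι] [DecidableEq ι] (f : (ι → Bool) → Bool) (C : Circuit ι), C.IsOver B2 → C.Computes f → ∃ ε : ℝ, 0 < ε ∧ ∃ r : ℕ, r ≤ κ * (C.size + Fintype.card ι + 1) ∧ ∃ (a b : (ι → Bool) → Fin r → ℝ), (∀ y i, 0 ≤ a y i) ∧ (∀ x i, 0 ≤ b x i) ∧ ∀ x y, f x = true → f y = false → (hammingDist x y : ℝ) - ε = ∑ i, a y i * b x i) → (∃ δ : ℝ, 0 < δ ∧ δ < 1 / 2 ∧ ∀ c : ℕ, ∀ᶠ m : ℕ in atTop, ∀ ε : ℝ, 0 < ε → ∀ r : ℕ, r ≤ m ^ c → ∀ (a : ((⊤ : SimpleGraph (Fin m)).edgeSet → Bool) → Fin r → ℝ) (b : Finset (Fin m) → Fin r → ℝ), (∀ u : (⊤ : SimpleGraph (Fin m)).edgeSet → Bool, (Finset.univ.filter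 fun e => u e = true).card < (⌈(m : ℝ) ^ δ⌉₊).choose 2 → ∀ i, 0 ≤ a u i) → (∀ Q : Finset (Fin m), Q.card = ⌈(m : ℝ) ^ δ⌉₊ → ∀ i, 0 ≤ b Q i) → ¬ ∀ (Q : Finset (Fin m)) (u : (⊤ : SimpleGraph (Fin m)).edgeSet → Bool), Q.card = ⌈(m : ℝ) ^ δ⌉₊ → (Finset.univ.filter fun e => u e = true).card < (⌈(m : ℝ) ^ δ⌉₊).choose 2 → ∑ e, (if u e then (0 : ℝ) else 1) * (if cliqueVec Q e then (1 : ℝ) else 0) - ε = ∑ i, a u i * b Q i) → ∃ δ : ℝ, 0 < δ ∧ δ < 1 / 2 ∧ ∀ c : ℕ, ∀ᶠ m : ℕ in atTop, ∀ C : Circuit ((⊤ : SimpleGraph (Fin m)).edgeSet), C.IsOver B2 → C.size ≤ m ^ c → ¬ C.Computes (cliqueFn m ⌈(m : ℝ) ^ δ⌉₊) := by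
  intro hT3 hS
  classical
  obtain ⟨κ, hκ⟩ := hT3
  obtain ⟨δ, hδ0, hδ1, hS⟩ := hS
  refine ⟨δ, hδ0, hδ1, fun c => ?_⟩
  filter_upwards [hS (c + 4), eventually_ge_atTop 2, eventually_ge_atTop (3 * κ + 1)] with m hm h2 h3κ
    C hB2 hsize hcomp
  -- Hrubeš's factorisation of the Hamming matrix of `CLIQUE(m, k)`
  set k := ⌈(m : ℝ) ^ δ⌉₊ with hk
  obtain ⟨ε, hε, r, hr, a, b, ha, hb, hfact⟩ :=
    hκ ((⊤ : SimpleGraph (Fin m)).edgeSet) (cliqueFn m k) C hB2 hcomp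
  -- the size of the sparse factorisation
  have hm2 : 3 * κ + 1 ≤ m ^ 2 := h3κ.trans (by nlinarith)
  have hr1 : r + 1 ≤ m ^ (c + 4) :=
    (Nat.add_le_add_right hr 1).trans (sparse_rank_bound h2 hm2 hsize (card_edgeSet_top_le m))
  -- the sparse factorisation at the uniform shift `(1 + ε)/2`
  have hε' : 0 < (1 + ε) / 2 := by positivity
  refine hm ((1 + ε) / 2) hε' (r + 1) hr1
    (fun u => Fin.snoc (fun i => a u i / 2)
      (((k.choose 2 : ℝ) - ∑ e, (if u e then (1 : ℝ) else 0) - 1) / 2))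
    (fun Q => Fin.snoc (fun i => b (cliqueVec Q) i) 1) (fun u hu i => ?_) (fun Q hQ i => ?_)
    (fun Q u hQ hu => ?_)
  · -- row factors are non-negative on sparse rows
    refine Fin.lastCases ?_ (fun i => ?_) i
    · rw [Fin.snoc_last]
      have hcard : (∑ e, (if u e then (1 : ℝ) else 0)) =
          ((univ.filter fun e : (⊤ : SimpleGraph (Fin m)).edgeSet => u e = true).card : ℝ) := by
        rw [Finset.natCast_card_filter]
      have hlt : ((univ.filter fun e : (⊤ : SimpleGraph (Fin m)).edgeSet => u e = true).card : ℝ) + 1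
          ≤ (k.choose 2 : ℝ) := by exact_mod_cast hu
      rw [hcard]
      linarith
    · rw [Fin.snoc_castSucc]
      exact div_nonneg (ha u i) (by norm_num)
  · -- column factors are non-negative
    refine Fin.lastCases ?_ (fun i => ?_) i
    · rw [Fin.snoc_last]; exact zero_le_one
    · rw [Fin.snoc_castSucc]; exact hb _ i
  · -- the identity on (k-set, sparse row)
    have hx : cliqueFn m k (cliqueVec Q) = true := cliqueFn_cliqueVec (by rw [hQ])
    have hy : cliqueFn m k u = false := cliqueFn_eq_false_of_card_lt u hu
    have hF := hfact (cliqueVec Q) u hx hy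
    have hH := hamming_cliqueVec_eq Q u
    have hCQ : ∑ e, (if cliqueVec Q e then (1 : ℝ) else 0) = (k.choose 2 : ℝ) := by
      rw [← hQ, ← card_filter_cliqueVec Q, Finset.natCast_card_filter]
    rw [Fin.sum_univ_castSucc]
    simp only [Fin.snoc_castSucc, Fin.snoc_last, mul_one]
    have h2 : ∑ i : Fin r, a u i / 2 * b (cliqueVec Q) i = (1 / 2) * ∑ i, a u i * b (cliqueVec Q) i := by
      rw [Finset.mul_sum]
      exact Finset.sum_congr rfl fun i _ => by ring
    rw [h2, ← hF, hH, hCQ]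
    ring

/-- **The sparse-negative LP sub-case of the crux already implies `P ≠ NP`** (conditional on Hrubeš's
Theorem 3, hypothesis `hT3`): `cliqueB2Hard_of_sparseCanonicalHard` composed with the proved
support item `cliqueBridge_proof` (`CliqueBridge`: super-polynomial B2 complexity of
`CLIQUE(m, ⌈m^δ⌉₊)` gives `PneNP`). So a lower-bound line for `ConvexGateBlind` that only ever uses
negatives with fewer than `C(k,2)` edges would be a direct proof of the summit — no convex gates, no
Capture, no monotone circuit theory in between; feasible lines must use dense negatives.
[Hrubeš 2020, Thm. 3] -/
theorem pneNP_of_sparseCanonicalHard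
    (hT3 : ∃ κ : ℕ, ∀ (ι : Type) [Fintype ι] [DecidableEq ι] (f : (ι → Bool) → Bool)
      (C : Circuit ι), C.IsOver B2 → C.Computes f →
        ∃ ε : ℝ, 0 < ε ∧ ∃ r : ℕ, r ≤ κ * (C.size + Fintype.card ι + 1) ∧
          ∃ (a b : (ι → Bool) → Fin r → ℝ), (∀ y i, 0 ≤ a y i) ∧ (∀ x i, 0 ≤ b x i) ∧
            ∀ x y, f x = true → f y = false →
              (hammingDist x y : ℝ) - ε = ∑ i, a y i * b x i)
    (hS : ∃ δ : ℝ, 0 < δ ∧ δ < 1 / 2 ∧ ∀ c : ℕ, ∀ᶠ m : ℕ in atTop, ∀ ε : ℝ, 0 < ε →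
      ∀ r : ℕ, r ≤ m ^ c →
        ∀ (a : ((⊤ : SimpleGraph (Fin m)).edgeSet → Bool) → Fin r → ℝ)
          (b : Finset (Fin m) → Fin r → ℝ),
          (∀ u : (⊤ : SimpleGraph (Fin m)).edgeSet → Bool,
            (univ.filter fun e => u e = true).card < (⌈(m : ℝ) ^ δ⌉₊).choose 2 → ∀ i, 0 ≤ a u i) →
          (∀ Q : Finset (Fin m), Q.card = ⌈(m : ℝ) ^ δ⌉₊ → ∀ i, 0 ≤ b Q i) →
          ¬ ∀ (Q : Finset (Fin m)) (u : (⊤ : SimpleGraph (Fin m)).edgeSet → Bool),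
              Q.card = ⌈(m : ℝ) ^ δ⌉₊ →
              (univ.filter fun e => u e = true).card < (⌈(m : ℝ) ^ δ⌉₊).choose 2 →
                ∑ e, (if u e then (0 : ℝ) else 1) * (if cliqueVec Q e then (1 : ℝ) else 0) - ε =
                  ∑ i, a u i * b Q i) :
    PneNP :=
  cliqueBridge_proof (cliqueB2Hard_of_sparseCanonicalHard hT3 hS)

end Summit.PneNP.PneNP.Theorems
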